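import Mathlib
import HarnessLib
import Summits.NavierStokesRegularity.NavierStokesRegularity.Theorems.UnthreadedDoorCapSymHeadPotential
import Summits.NavierStokesRegularity.NavierStokesRegularity.Theorems.UnthreadedDoorToroidalPotentialClosed

/-!
# Route `UnthreadedDoor`, crux `PoloidalLiouville` (stmt-NavierStokesRegularity-1222), WALL W1 `stub_scalarLiouville` —
# crux idea «netflux-typei-gap» (ns-idea-14 g2): NF-0 `NetFlux.oscLeVorticity : NetFlux.OscLeVorticity`

KEY-NS #153 (d) (director-ns g16; author ns-idea-14; critic of record ns-wall-crit-1): the support statement NF-0 of the netflux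
line (registered stub `stub_oscLeVorticity : NetFlux.OscLeVorticity` of `Cruxes/PoloidalLiouville/Lines/netflux_typei_gap.lean`),
`osc_{S_r(x₀)} T ≤ π · sup_{S_r(x₀)} ‖ω‖` for `ω = curl v = ∇T × (x − x₀)`, `T ∈ C¹` off `x₀`, `r > 0`.  The statement below is
the Prop `NetFlux.OscLeVorticity` of the sketch VERBATIM with its objects `sphOsc = sphSup − sphInf`, `sphSup f x₀ r = sSup (f '' S_r(x₀))`,
`sphInf f x₀ r = sInf (f '' S_r(x₀))` UNFOLDED (a Theorems file cannot import the `Cruxes` sketch), so that the stub closes BY NAME: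
`theorem stub_oscLeVorticity : OscLeVorticity := Theorems.PoloidalLiouville.NetFlux.oscLeVorticity` (definitional unfolding).  Proof: any two
points `p, q` of the sphere lie on a great circle `γ(θ) = x₀ + cos θ · a + sin θ · (n × a)`, `a = p − x₀`, `n ⊥ a` a unit pole,
`q = γ(θ₀)` with `θ₀ ∈ [0, π]` (`exists_greatCircle`); `γ′ = n × (γ − x₀)` and `(T ∘ γ)′ = ⟪∇T, n × y⟫ = −⟪n, ∇T × y⟫`, so
`|(T ∘ γ)′| ≤ ‖ω‖ ≤ K` on the sphere; the mean value inequality gives `T q − T p ≤ K θ₀ ≤ π K`, whence `sSup − sInf ≤ π K`.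
(The hypothesis `ContDiff ℝ 1 v` of NF-0 is idle: `curl v` enters only through the pointwise identity.)

* vector algebra of great circles: `cross_cross_eq_neg_of_unit_orth` (`n × (n × a) = −a`), `norm_cross_of_unit_orth`,
  `inner_cross_right_eq_neg_inner_cross` (triple product), `cross_add_smul_right` (and the tree's
  `PoloidalLiouville.cross_cross_self`, `CapSym.inner_cross_cross`);
* `exists_unit_orth` (a unit vector orthogonal to a given one, by a rank count in `(ℝ ∙ a)ᗮ`), `exists_greatCircle`;
* `sub_le_pi_mul_of_norm_cross_gradient_le` — the arc bound; `oscLeVorticity` — NF-0.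

WHAT THIS IS NOT: no NS-regularity statement is touched; NF-0 is a SUPPORT input of one crux idea card; `PoloidalLiouville`
(1222), W1, the line's targets and the summit stay OPEN.  `--supports stmt-NavierStokesRegularity-1222 --as helper`.  [folklore]
-/

noncomputable section

-- the summit and its single sub-problem share the name (CONVENTIONS §1)
set_option linter.dupNamespace false

open Set Function Filter Topology InnerProductSpace
open scoped RealInnerProductSpace

namespace Summit.NavierStokesRegularity.NavierStokesRegularity.Theorems.PoloidalLiouville.NetFlux

open Literature.Analysis Literature.Analysis.FluidPDE

/-! ### Vector algebra of great circles -/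

/-- `n × (n × a) = −a` for a unit `n ⊥ a` (BAC–CAB). [folklore] -/
theorem cross_cross_eq_neg_of_unit_orth {n a : EuclideanSpace ℝ (Fin 3)} (hn : ‖n‖ = 1) (hna : ⟪n, a⟫ = 0) :
    cross n (cross n a) = -a := by
  have hn2 : n 0 * n 0 + n 1 * n 1 + n 2 * n 2 = 1 := by
    rw [← Tao2016.real_inner_fin3, real_inner_self_eq_norm_sq, hn, one_pow]
  rw [Tao2016.real_inner_fin3] at hna
  ext i
  fin_cases i
  · simp only [Fin.zero_eta, Fin.isValue, cross_apply_zero, cross_apply_one, cross_apply_two, PiLp.neg_apply]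
    linear_combination n 0 * hna - a 0 * hn2
  · simp only [Fin.mk_one, Fin.isValue, cross_apply_zero, cross_apply_one, cross_apply_two, PiLp.neg_apply]
    linear_combination n 1 * hna - a 1 * hn2
  · simp only [Fin.reduceFinMk, cross_apply_zero, cross_apply_one, cross_apply_two, PiLp.neg_apply]
    linear_combination n 2 * hna - a 2 * hn2

/-- `‖n × a‖ = ‖a‖` for a unit `n ⊥ a` (Lagrange). [folklore] -/
theorem norm_cross_of_unit_orth {n a : EuclideanSpace ℝ (Fin 3)} (hn : ‖n‖ = 1) (hna : ⟪n, a⟫ = 0) :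
    ‖cross n a‖ = ‖a‖ := by
  have h : ‖cross n a‖ ^ 2 = ‖a‖ ^ 2 := by
    rw [← real_inner_self_eq_norm_sq, CapSym.inner_cross_cross, real_inner_self_eq_norm_sq, hn, hna,
      real_inner_self_eq_norm_sq]
    ring
  nlinarith [norm_nonneg (cross n a), norm_nonneg a, sq_nonneg (‖cross n a‖ - ‖a‖), sq_nonneg (‖cross n a‖ + ‖a‖)]

/-- The triple product: `⟪g, n × y⟫ = −⟪n, g × y⟫`. [folklore] -/
theorem inner_cross_right_eq_neg_inner_cross (g n y : EuclideanSpace ℝ (Fin 3)) :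
    ⟪g, cross n y⟫ = -⟪n, cross g y⟫ := by
  simp only [Tao2016.real_inner_fin3, cross_apply_zero, cross_apply_one, cross_apply_two]
  ring

/-- `n × (c • a + d • w) = c • (n × a) + d • (n × w)`. [folklore] -/
theorem cross_add_smul_right (n a w : EuclideanSpace ℝ (Fin 3)) (c d : ℝ) :
    cross n (c • a + d • w) = c • cross n a + d • cross n w := by
  rw [← crossCLM_apply, map_add, map_smul, map_smul, crossCLM_apply, crossCLM_apply]

/-- In `ℝ³` every vector has a unit vector orthogonal to it. [folklore] -/
theorem exists_unit_orth (a : EuclideanSpace ℝ (Fin 3)) :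
    ∃ n : EuclideanSpace ℝ (Fin 3), ‖n‖ = 1 ∧ ⟪n, a⟫ = 0 := by
  set K : Submodule ℝ (EuclideanSpace ℝ (Fin 3)) := ℝ ∙ a with hK
  have hpos : 0 < Module.finrank ℝ Kᗮ := by
    have h := Submodule.finrank_add_finrank_orthogonal K
    rw [finrank_euclideanSpace_fin] at h
    have h1 : Module.finrank ℝ K ≤ 1 := (finrank_span_le_card ({a} : Set (EuclideanSpace ℝ (Fin 3)))).trans (by simp)
    omega
  obtain ⟨m, hm⟩ := (Module.finrank_pos_iff_exists_ne_zero (R := ℝ) (M := Kᗮ)).1 hpos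
  have hm0 : (m : EuclideanSpace ℝ (Fin 3)) ≠ 0 := by
    intro h; exact hm (Subtype.ext h)
  have hma : ⟪(m : EuclideanSpace ℝ (Fin 3)), a⟫ = 0 := by
    rw [real_inner_comm]
    exact (Submodule.mem_orthogonal_singleton_iff_inner_right).1 m.2
  refine ⟨‖(m : EuclideanSpace ℝ (Fin 3))‖⁻¹ • (m : EuclideanSpace ℝ (Fin 3)), ?_, ?_⟩
  · rw [norm_smul, norm_inv, norm_norm, inv_mul_cancel₀ (norm_ne_zero_iff.2 hm0)]
  · rw [real_inner_smul_left, hma, mul_zero]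

/-- **Great-circle chart of a sphere point.**  For `a, b` of the same norm `r > 0` there are a unit vector `n ⊥ a` and an
angle `θ₀ ∈ [0, π]` with `b = cos θ₀ · a + sin θ₀ · (n × a)` (the great circle through `a` and `b`). [folklore] -/
theorem exists_greatCircle {a b : EuclideanSpace ℝ (Fin 3)} {r : ℝ} (hr : 0 < r) (ha : ‖a‖ = r) (hb : ‖b‖ = r) :
    ∃ n : EuclideanSpace ℝ (Fin 3), ∃ θ₀ : ℝ, ‖n‖ = 1 ∧ ⟪n, a⟫ = 0 ∧ θ₀ ∈ Icc 0 Real.pi ∧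
      b = Real.cos θ₀ • a + Real.sin θ₀ • cross n a := by
  have hr2 : r ^ 2 ≠ 0 := pow_ne_zero 2 hr.ne'
  -- Lagrange: `‖a × b‖² = r⁴ − ⟪a,b⟫²`
  have hlag : ‖cross a b‖ ^ 2 = r ^ 2 * r ^ 2 - ⟪a, b⟫ ^ 2 := by
    rw [← real_inner_self_eq_norm_sq, CapSym.inner_cross_cross, real_inner_self_eq_norm_sq,
      real_inner_self_eq_norm_sq, ha, hb, real_inner_comm a b]
    ring
  -- the cosine `x = ⟪a,b⟫ / r²` lies in `[-1, 1]`
  set x : ℝ := ⟪a, b⟫ / r ^ 2 with hx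
  have hxab : ⟪a, b⟫ = x * r ^ 2 := by rw [hx]; field_simp
  have hx1 : x ^ 2 ≤ 1 := by
    have h0 : 0 ≤ ‖cross a b‖ ^ 2 := sq_nonneg _
    rw [hlag, hxab] at h0
    have : x ^ 2 * (r ^ 2 * r ^ 2) ≤ 1 * (r ^ 2 * r ^ 2) := by nlinarith
    exact le_of_mul_le_mul_right this (by positivity)
  have hxI : -1 ≤ x ∧ x ≤ 1 := abs_le.1 (by rw [← sq_le_one_iff_abs_le_one]; exact hx1)
  by_cases hc : cross a b = 0
  · -- `a, b` parallel: `b = ± a`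
    obtain ⟨n, hn1, hna⟩ := exists_unit_orth a
    have hx2 : x ^ 2 = 1 := by
      have h := hlag
      rw [hc, norm_zero, hxab] at h
      have : (x ^ 2 - 1) * (r ^ 2 * r ^ 2) = 0 := by nlinarith
      rcases mul_eq_zero.1 this with h' | h'
      · linarith
      · exact absurd h' (by positivity)
    rcases sq_eq_one_iff.1 hx2 with h1 | h1
    · -- `b = a`
      refine ⟨n, 0, hn1, hna, ⟨le_rfl, Real.pi_pos.le⟩, ?_⟩
      have hab : ‖b - a‖ ^ 2 = 0 := by
        rw [← real_inner_self_eq_norm_sq, inner_sub_left, inner_sub_right, inner_sub_right,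
          real_inner_self_eq_norm_sq, real_inner_self_eq_norm_sq, ha, hb, real_inner_comm a b, hxab, h1]
        ring
      have : b = a := by
        rw [← sub_eq_zero]; exact norm_eq_zero.1 ((pow_eq_zero_iff two_ne_zero).1 hab)
      rw [this, Real.cos_zero, Real.sin_zero, one_smul, zero_smul, add_zero]
    · -- `b = -a`
      refine ⟨n, Real.pi, hn1, hna, ⟨Real.pi_pos.le, le_rfl⟩, ?_⟩
      have hab : ‖b + a‖ ^ 2 = 0 := by
        rw [← real_inner_self_eq_norm_sq, inner_add_left, inner_add_right, inner_add_right,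
          real_inner_self_eq_norm_sq, real_inner_self_eq_norm_sq, ha, hb, real_inner_comm a b, hxab, h1]
        ring
      have : b = -a := by
        rw [← add_eq_zero_iff_eq_neg]; exact norm_eq_zero.1 ((pow_eq_zero_iff two_ne_zero).1 hab)
      rw [this, Real.cos_pi, Real.sin_pi, neg_one_smul, zero_smul, add_zero]
  · -- generic: pole `n = (a × b)/‖a × b‖`, angle `θ₀ = arccos x`
    have hcn : ‖cross a b‖ ≠ 0 := norm_ne_zero_iff.2 hc
    set n : EuclideanSpace ℝ (Fin 3) := ‖cross a b‖⁻¹ • cross a b with hn_def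
    have hn1 : ‖n‖ = 1 := by rw [hn_def, norm_smul, norm_inv, norm_norm, inv_mul_cancel₀ hcn]
    have hca : ⟪cross a b, a⟫ = 0 := by
      simp only [Tao2016.real_inner_fin3, cross_apply_zero, cross_apply_one, cross_apply_two]; ring
    have hna : ⟪n, a⟫ = 0 := by
      rw [hn_def, real_inner_smul_left, hca, mul_zero]
    have hsin : Real.sin (Real.arccos x) = ‖cross a b‖ / r ^ 2 := by
      rw [Real.sin_arccos]
      have e : 1 - x ^ 2 = (‖cross a b‖ / r ^ 2) ^ 2 := by
        rw [div_pow ‖cross a b‖ (r ^ 2) 2, hlag, hxab]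
        field_simp
      rw [e, Real.sqrt_sq (by positivity)]
    refine ⟨n, Real.arccos x, hn1, hna, ⟨Real.arccos_nonneg x, Real.arccos_le_pi x⟩, ?_⟩
    have hsl : cross (‖cross a b‖⁻¹ • cross a b) a = ‖cross a b‖⁻¹ • cross (cross a b) a := by
      rw [← crossCLM_apply (‖cross a b‖⁻¹ • cross a b) a, map_smul, _root_.smul_apply, crossCLM_apply]
    rw [Real.cos_arccos hxI.1 hxI.2, hsin, hn_def, hsl, cross_cross_self, ha, hxab, smul_smul]
    have hcoef : ‖cross a b‖ / r ^ 2 * ‖cross a b‖⁻¹ = (r ^ 2)⁻¹ := by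
      field_simp
    rw [hcoef, smul_sub, smul_smul, smul_smul, inv_mul_cancel₀ hr2, one_smul,
      show (r ^ 2)⁻¹ * (x * r ^ 2) = x by field_simp]
    abel

/-! ### The oscillation over a sphere is at most `π · sup ‖∇T × (x − x₀)‖` -/

/-- **Arc bound.**  If `T ∈ C¹` off `x₀` and `‖∇T(x) × (x − x₀)‖ ≤ K` on the sphere `S_r(x₀)`, `r > 0`, then
`T q − T p ≤ π K` for all `p, q ∈ S_r(x₀)`: along the great circle `γ` from `p` to `q`,
`(T ∘ γ)' = ⟪∇T, n × y⟫ = −⟪n, ∇T × y⟫`, of size `≤ K`, over an angle `≤ π`. [folklore] -/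
theorem sub_le_pi_mul_of_norm_cross_gradient_le {T : EuclideanSpace ℝ (Fin 3) → ℝ} {x₀ : EuclideanSpace ℝ (Fin 3)}
    {r K : ℝ} (hr : 0 < r) (hT : ContDiffOn ℝ 1 T ({x₀}ᶜ))
    (hK : ∀ x ∈ Metric.sphere x₀ r, ‖cross (gradient T x) (x - x₀)‖ ≤ K)
    {p q : EuclideanSpace ℝ (Fin 3)} (hp : p ∈ Metric.sphere x₀ r) (hq : q ∈ Metric.sphere x₀ r) :
    T q - T p ≤ Real.pi * K := by
  rw [mem_sphere_iff_norm] at hp hq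
  obtain ⟨n, θ₀, hn1, hna, hθ₀, hb⟩ := exists_greatCircle (a := p - x₀) (b := q - x₀) hr hp hq
  have hK0 : 0 ≤ K := (norm_nonneg _).trans (hK p (mem_sphere_iff_norm.2 hp))
  -- the great circle
  set γ : ℝ → EuclideanSpace ℝ (Fin 3) := fun θ => x₀ + (Real.cos θ • (p - x₀) + Real.sin θ • cross n (p - x₀))
    with hγ_def
  have hγ0 : γ 0 = p := by simp [hγ_def]
  have hγ1 : γ θ₀ = q := by rw [hγ_def]; simp only; rw [← hb]; abel
  have hγr : ∀ θ, ‖γ θ - x₀‖ = r := by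
    intro θ
    have hsq : ‖γ θ - x₀‖ ^ 2 = r ^ 2 := by
      rw [hγ_def]
      simp only [add_sub_cancel_left]
      have hac : ⟪p - x₀, cross n (p - x₀)⟫ = 0 := by
        simp only [Tao2016.real_inner_fin3, cross_apply_zero, cross_apply_one, cross_apply_two]; ring
      rw [← real_inner_self_eq_norm_sq, inner_add_left, inner_add_right, inner_add_right, real_inner_smul_left,
        real_inner_smul_left, real_inner_smul_left, real_inner_smul_left, real_inner_smul_right,
        real_inner_smul_right, real_inner_smul_right, real_inner_smul_right, real_inner_self_eq_norm_sq,
        real_inner_self_eq_norm_sq, norm_cross_of_unit_orth hn1 hna, hp, hac,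
        real_inner_comm (p - x₀) (cross n (p - x₀)), hac]
      linear_combination r ^ 2 * Real.cos_sq_add_sin_sq θ
    have h := Real.sqrt_sq (norm_nonneg (γ θ - x₀))
    rw [hsq, Real.sqrt_sq hr.le] at h
    exact h.symm
  have hγne : ∀ θ, γ θ ≠ x₀ := fun θ h => by
    have := hγr θ
    rw [h, sub_self, norm_zero] at this
    exact hr.ne' this.symm
  -- derivative of the great circle: `γ' = n × (γ − x₀)`
  have hγd : ∀ θ, HasDerivAt γ (cross n (γ θ - x₀)) θ := by
    intro θ
    have h := (((Real.hasDerivAt_cos θ).smul_const (p - x₀)).add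
      ((Real.hasDerivAt_sin θ).smul_const (cross n (p - x₀)))).const_add x₀
    have e : cross n (γ θ - x₀) = -Real.sin θ • (p - x₀) + Real.cos θ • cross n (p - x₀) := by
      rw [hγ_def]
      simp only [add_sub_cancel_left]
      rw [cross_add_smul_right, cross_cross_eq_neg_of_unit_orth hn1 hna, smul_neg, ← neg_smul]
      abel
    rw [e]
    exact h
  -- derivative of `T ∘ γ` and its bound
  have hTd : ∀ θ, HasDerivAt (fun θ => T (γ θ)) (fderiv ℝ T (γ θ) (cross n (γ θ - x₀))) θ := by
    intro θ
    have hd : DifferentiableAt ℝ T (γ θ) :=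
      (hT.differentiableOn one_ne_zero _ (hγne θ)).differentiableAt (isOpen_compl_singleton.mem_nhds (hγne θ))
    exact hd.hasFDerivAt.comp_hasDerivAt θ (hγd θ)
  have hbound : ∀ θ, ‖fderiv ℝ T (γ θ) (cross n (γ θ - x₀))‖ ≤ K := by
    intro θ
    rw [← LocalHelmholtz.inner_gradient_left_eq_fderiv, inner_cross_right_eq_neg_inner_cross, norm_neg,
      Real.norm_eq_abs]
    calc |⟪n, cross (gradient T (γ θ)) (γ θ - x₀)⟫| ≤ ‖n‖ * ‖cross (gradient T (γ θ)) (γ θ - x₀)‖ :=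
          abs_real_inner_le_norm _ _
      _ ≤ 1 * K := by
          rw [hn1]
          exact mul_le_mul_of_nonneg_left (hK _ (mem_sphere_iff_norm.2 (hγr θ))) zero_le_one
      _ = K := one_mul K
  -- mean value inequality on `[0, θ₀]`
  have hmv := Convex.norm_image_sub_le_of_norm_hasDerivWithin_le (s := univ)
    (f := fun θ => T (γ θ)) (fun θ _ => (hTd θ).hasDerivWithinAt) (fun θ _ => hbound θ) convex_univ
    (mem_univ 0) (mem_univ θ₀)
  rw [hγ0, hγ1, sub_zero, Real.norm_eq_abs, Real.norm_eq_abs, abs_of_nonneg hθ₀.1] at hmv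
  calc T q - T p ≤ |T q - T p| := le_abs_self _
    _ ≤ K * θ₀ := hmv
    _ ≤ K * Real.pi := mul_le_mul_of_nonneg_left hθ₀.2 hK0
    _ = Real.pi * K := mul_comm _ _

/-- **NF-0 (`NetFlux.OscLeVorticity`, objects unfolded): `osc_{S_r(x₀)} T = sup_{S_r} T − inf_{S_r} T ≤ π · sup_{S_r(x₀)} ‖ω‖`**
for `ω = curl v = ∇T × (x − x₀)`, `T ∈ C¹` off `x₀`, `r > 0` (`|∇_{S_r} T| = ‖ω‖/r`, geodesic diameter `π r`). [folklore] -/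
theorem oscLeVorticity :
    ∀ (v : EuclideanSpace ℝ (Fin 3) → EuclideanSpace ℝ (Fin 3)) (x₀ : EuclideanSpace ℝ (Fin 3))
      (T : EuclideanSpace ℝ (Fin 3) → ℝ) (r K : ℝ), 0 < r →
      ContDiff ℝ 1 v → ContDiffOn ℝ 1 T ({x₀}ᶜ) →
      (∀ x, curl v x = cross (gradient T x) (x - x₀)) →
      (∀ x ∈ Metric.sphere x₀ r, ‖curl v x‖ ≤ K) →
      sSup (T '' Metric.sphere x₀ r) - sInf (T '' Metric.sphere x₀ r) ≤ Real.pi * K := by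
  intro v x₀ T r K hr _hv hT hcurl hK
  have hK' : ∀ x ∈ Metric.sphere x₀ r, ‖cross (gradient T x) (x - x₀)‖ ≤ K := fun x hx => by
    rw [← hcurl x]; exact hK x hx
  have hpair : ∀ p ∈ Metric.sphere x₀ r, ∀ q ∈ Metric.sphere x₀ r, T q - T p ≤ Real.pi * K :=
    fun p hp q hq => sub_le_pi_mul_of_norm_cross_gradient_le hr hT hK' hp hq
  -- the sphere is nonempty
  have hne : (T '' Metric.sphere x₀ r).Nonempty := by
    refine ⟨T (x₀ + r • EuclideanSpace.single 0 1), x₀ + r • EuclideanSpace.single 0 1, ?_, rfl⟩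
    rw [mem_sphere_iff_norm, add_sub_cancel_left, norm_smul, PiLp.norm_single, norm_one, mul_one,
      Real.norm_eq_abs, abs_of_pos hr]
  rw [sub_le_iff_le_add]
  refine csSup_le hne ?_
  rintro _ ⟨q, hq, rfl⟩
  rw [← sub_le_iff_le_add']
  refine le_csInf hne ?_
  rintro _ ⟨p, hp, rfl⟩
  linarith [hpair p hp q hq]

end Summit.NavierStokesRegularity.NavierStokesRegularity.Theorems.PoloidalLiouville.NetFlux

end
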